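import Summits.AtomisticToContinuum.Crystallization.Theses.NashClassCertificates
import Summits.AtomisticToContinuum.Crystallization.Theorems.NashClassCertificatesNashHullBridge
import Summits.AtomisticToContinuum.Crystallization.Theorems.NashClassCertificatesNashTwoShellGapBadFractionOfBadPhaseGap

/-!
# Crux `NashTwoShellGap` (stmt-AtomisticToContinuum-16826), line `bulk_dilute`: the route's deciding theorem
# survives with the crux replaced by the Nash-free flat bad-phase gap

`closes` of route `NashClassCertificates` consumes the crux `NashTwoShellGap` only through `NashHullBridge`
(`LayeredWindowsLocal.nashHullBridge_proof`), i.e. only through the vanishing of the bad fraction of Lennard-Jones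
ground states (`badFraction_of_nashTwoShellGap`).  The landed stub `stub_badFractionOfBadPhaseGap` (p161727) derives
that vanishing from the BULK stub of line `bulk_dilute` alone — the flat bad-phase gap on the torus, with NO Nash
hypothesis and NO linear rate.  Hence (this file, registered sub-goal `stub_crystallizationOfBadPhaseGap`):

  `stub_badPhaseGap → NashNearField → PeriodicGivenLayered → Crystallization`,

by the proof of `closes` with `goodWindows_of_badFraction ∘ stub_badFractionOfBadPhaseGap` in place of
`goodWindows_of_nashTwoShellGap`: layered windows (`layeredWindows_seq_of_goodWindows`), periodic windows
(`PeriodicGivenLayered`), the positional conjunct by the PROVED hull criterion (`PrestressSplitKorn.stub_hullCriterion`),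
the energetic conjunct by ground-state existence, `windowOptimality_proof` and `crysEnergyLimit_proof`.
Reading for the planners: the dilute / Nash-specific half of the crux is not needed by THIS assembly; the route's
honest open ask at the energetic end is the flat bad-phase gap (shared core B of STRATEGY-CENSUS §0 F3), and
`NashNearField` (16827) remains the other open hypothesis.  No definitions; all `[folklore]`.
-/

noncomputable section

namespace Summit.AtomisticToContinuum.Crystallization.Theorems.NashTwoShellGapCrystallizationOfBadPhaseGap

open scoped BigOperators Classical
open Filter
open Literature.MathematicalPhysics.StatisticalMechanics Literature.Geometry.DiscreteGeometry
open Summit.AtomisticToContinuum.Crystallization.Theses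

/-- **Good windows from the bulk stub**: under the flat bad-phase gap, along every sequence of Lennard-Jones ground
states and for every radius `ρ`, eventually some particle has every particle within `ρ` of it two-shell good
(`stub_badFractionOfBadPhaseGap` + the packing lemma `goodWindows_of_badFraction`). [folklore] -/
theorem goodWindows_of_badPhaseGap (hB : ∀ β₀ : ℝ, 0 < β₀ → ∃ γ : ℝ, 0 < γ ∧ ∀ P : Literature.MathematicalPhysics.StatisticalMechanics.PeriodicConfiguration 3, (∀ u ∈ P.points, ∀ v ∈ P.points, u ≠ v → (1 / 3 : ℝ) ≤ dist u v) → β₀ * (P.motif.card : ℝ) ≤ ((P.motif.filter fun y => ¬ Literature.Geometry.DiscreteGeometry.IsTwoShellGoodSet (1 / 20) (47 / 50) 1 P.points y).card : ℝ) → (⨅ Q : Literature.MathematicalPhysics.StatisticalMechanics.PeriodicConfiguration 3, Q.energyPerParticle Literature.MathematicalPhysics.StatisticalMechanics.lennardJones) + γ ≤ P.energyPerParticle Literature.MathematicalPhysics.StatisticalMechanics.lennardJones)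
    (x : (N : ℕ) → (Fin N → EuclideanSpace ℝ (Fin 3))) (hx : ∀ N, IsGroundState lennardJones (x N)) (ρ : ℝ) :
    ∀ᶠ N : ℕ in atTop, ∃ i : Fin N, ∀ j : Fin N,
      dist (x N j) (x N i) ≤ ρ → IsTwoShellGood (1 / 20) (47 / 50) 1 (x N) j :=
  LayeredWindowsLocal.goodWindows_of_badFraction x hx
    (NashTwoShellGapBadFractionOfBadPhaseGap.stub_badFractionOfBadPhaseGap hB x hx) ρ

/-- **Layered windows from the bulk stub and the Nash near field** (the route's `LayeredWindows`, item 11778, as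
re-asked by `NashClassCertificates`): `goodWindows_of_badPhaseGap` fed into the localised bridge
`layeredWindows_seq_of_goodWindows`. [folklore] -/
theorem layeredWindows_of_badPhaseGap (hB : ∀ β₀ : ℝ, 0 < β₀ → ∃ γ : ℝ, 0 < γ ∧ ∀ P : Literature.MathematicalPhysics.StatisticalMechanics.PeriodicConfiguration 3, (∀ u ∈ P.points, ∀ v ∈ P.points, u ≠ v → (1 / 3 : ℝ) ≤ dist u v) → β₀ * (P.motif.card : ℝ) ≤ ((P.motif.filter fun y => ¬ Literature.Geometry.DiscreteGeometry.IsTwoShellGoodSet (1 / 20) (47 / 50) 1 P.points y).card : ℝ) → (⨅ Q : Literature.MathematicalPhysics.StatisticalMechanics.PeriodicConfiguration 3, Q.energyPerParticle Literature.MathematicalPhysics.StatisticalMechanics.lennardJones) + γ ≤ P.energyPerParticle Literature.MathematicalPhysics.StatisticalMechanics.lennardJones)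
    (hNF : NashClassCertificates.NashNearField) : NashClassCertificates.LayeredWindows :=
  fun x hx => LayeredWindowsLocal.layeredWindows_seq_of_goodWindows hNF x hx (goodWindows_of_badPhaseGap hB x hx)

/-- **Registered sub-goal `stub_crystallizationOfBadPhaseGap`** — the deciding theorem of route
`NashClassCertificates` with its crux `NashTwoShellGap` REPLACED by the Nash-free flat bad-phase gap of line
`bulk_dilute`: `stub_badPhaseGap → NashNearField → PeriodicGivenLayered → Crystallization` (proof of `closes`
verbatim after the first line). [folklore] -/
theorem stub_crystallizationOfBadPhaseGap : (∀ β₀ : ℝ, 0 < β₀ → ∃ γ : ℝ, 0 < γ ∧ ∀ P : Literature.MathematicalPhysics.StatisticalMechanics.PeriodicConfiguration 3, (∀ u ∈ P.points, ∀ v ∈ P.points, u ≠ v → (1 / 3 : ℝ) ≤ dist u v) → β₀ * (P.motif.card : ℝ) ≤ ((P.motif.filter fun y => ¬ Literature.Geometry.DiscreteGeometry.IsTwoShellGoodSet (1 / 20) (47 / 50) 1 P.points y).card : ℝ) → (⨅ Q : Literature.MathematicalPhysics.StatisticalMechanics.PeriodicConfiguration 3, Q.energyPerParticle Literature.MathematicalPhysics.StatisticalMechanics.lennardJones)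 + γ ≤ P.energyPerParticle Literature.MathematicalPhysics.StatisticalMechanics.lennardJones) → Summit.AtomisticToContinuum.Crystallization.Theses.NashClassCertificates.NashNearField → Summit.AtomisticToContinuum.Crystallization.Theses.NashClassCertificates.PeriodicGivenLayered → _root_.Crystallization := by
  intro hB hNF hPGL
  -- (1) layered windows of every sequence of ground states: bulk stub + Nash near field
  have hLW : NashClassCertificates.LayeredWindows := layeredWindows_of_badPhaseGap hB hNF
  -- (2) stacking selection inside the hull: layered ⇒ periodic windows
  have hPW : NashClassCertificates.PeriodicWindows := fun y hy => hPGL y hy (hLW y hy)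
  -- (3) positional conjunct (ii): the hull criterion is PROVED in tree
  have hpos : IsCrystallizing lennardJones 3 := PrestressSplitKorn.stub_hullCriterion hPW
  -- (4) energetic conjunct (i): ground states exist; their periodic window is least; `E(N)/N → e(P)`
  obtain ⟨x, hx⟩ : ∃ x : (N : ℕ) → (Fin N → EuclideanSpace ℝ (Fin 3)), ∀ N, IsGroundState lennardJones (x N) :=
    ⟨fun N => (LennardJonesGroundStatesExist_holds N).choose,
      fun N => (LennardJonesGroundStatesExist_holds N).choose_spec⟩
  obtain ⟨P, hP⟩ := hPW x hx
  have hleast : IsLeast (Set.range fun Q : PeriodicConfiguration 3 => Q.energyPerParticle lennardJones)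
      (P.energyPerParticle lennardJones) :=
    windowOptimality_proof x hx P hP
  have hinf : (⨅ Q : PeriodicConfiguration 3, Q.energyPerParticle lennardJones) =
      P.energyPerParticle lennardJones := hleast.csInf_eq
  have hlim : Tendsto (fun N : ℕ => groundStateEnergy lennardJones 3 N / N) atTop
      (nhds (P.energyPerParticle lennardJones)) := by
    have h0 : Tendsto (fun N : ℕ => groundStateEnergy lennardJones 3 N / N) atTop
        (nhds (⨅ Q : PeriodicConfiguration 3, Q.energyPerParticle lennardJones)) := crysEnergyLimit_proof
    rw [hinf] at h0
    exact h0
  exact ⟨⟨P, hleast, hlim⟩, hpos⟩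

end Summit.AtomisticToContinuum.Crystallization.Theorems.NashTwoShellGapCrystallizationOfBadPhaseGap

end
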